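import Literature.NumberTheory.GaloisRepresentations.LubinTateColemanRelativeCoordTwo
import HarnessLib

/-!
# The relative anomaly map `c ↦ c − u·φ(c)` of `𝒪_E` is injective when `u^{[E:F]} ≠ 1` (de Shalit I §3.7: `N < ∞`)

De Shalit, *Iwasawa theory of elliptic curves with complex multiplication* (1987), Ch. I §3.7: the anomaly index `N` of `F_f` over
the unramified base `k'` (`[k' : ℚ_p] = d`) is finite unless `p^d ξ⁻¹ ≡ 1`, i.e. unless `F_f ≅ 𝔾̂_m` over `𝒪'`.  In the power-series
currency of `LubinTateColemanRelativeCoordKernelTwo` / `…ExactPrincipalTwo` the left exactness of Theorem I.3.7 over `k' = E` is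
stated under the hypothesis that `c ↦ c − u·φ(c)` (`π = 2u`, `φ` the Frobenius of `𝒪_E`) is injective on `𝒪_E`; this file
discharges it from the numerical condition **`u^{[E:F]} ≠ 1`**:

* `frobUnitBall_pow_finrank_apply` — `φ^{[E:F]} = id` on `𝒪_E` (`E/F` Galois);
* ★ `eq_zero_of_eq_mul_frobUnitBall` — **if `u^{[E:F]} ≠ 1` in `𝒪_F` then `c = u·φ(c) ⟹ c = 0`** (`c = u^k φ^k(c)` for all `k`,
  so `(1 − u^{[E:F]}) c = 0`).

Everything PROVED (0 sorry).

## References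

* E. de Shalit, *Iwasawa theory of elliptic curves with complex multiplication* (1987), Ch. I §3.7. [deShalit1987]
-/

noncomputable section

namespace Literature.NumberTheory.GaloisRepresentations

section RelativeAnomalyTwo

open GaloisRepresentations.IsNonarchimedeanLocalField LubinTate ValuativeRel Field

variable {F : Type} [Field F] [ValuativeRel F] [TopologicalSpace F] [IsNonarchimedeanLocalField F]

attribute [local instance] ltNormUniformSpace ltNormIsUniformAddGroup rk1 nF nE fintypeResidueField

variable (E : IntermediateField F (AlgebraicClosure F)) [FiniteDimensional F E] [Normal F E]

/-- `(φ^k c : E) = (σ₀|_E)^k (c : E)`: powers of the Frobenius of `𝒪_E` are restrictions of powers of `σ₀|_E`.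
[cite: deShalit1987, Ch. I §1.1] -/
theorem coe_frobUnitBall_pow_apply (σ₀ : absoluteGaloisGroup F) (k : ℕ) (c : unitBall E) :
    ((((frobUnitBall E σ₀ : unitBall E →+* unitBall E) ^ k) c : unitBall E) : E) =
      (((absoluteGaloisGroup.toAlgEquiv F σ₀).restrictNormal E) ^ k) (c : E) := by
  induction k with
  | zero => rw [pow_zero, pow_zero, RingHom.one_def, RingHom.id_apply, AlgEquiv.one_apply]
  | succ k ih =>
    rw [pow_succ', RingHom.mul_def, RingHom.comp_apply, pow_succ', AlgEquiv.mul_apply, ← ih]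
    rfl

/-- **`φ^{[E:F]} = id` on `𝒪_E`** for `E/F` Galois (the Galois group has order `[E:F]`). [cite: deShalit1987, Ch. I §1.1] -/
theorem frobUnitBall_pow_finrank_apply [IsGalois F E] (σ₀ : absoluteGaloisGroup F) (c : unitBall E) :
    ((frobUnitBall E σ₀ : unitBall E →+* unitBall E) ^ Module.finrank F E) c = c := by
  apply Subtype.ext
  have h1 : ((absoluteGaloisGroup.toAlgEquiv F σ₀).restrictNormal E) ^ Nat.card (E ≃ₐ[F] E) = 1 :=
    orderOf_dvd_iff_pow_eq_one.mp (orderOf_dvd_natCard _)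
  rw [coe_frobUnitBall_pow_apply, ← IsGalois.card_aut_eq_finrank, h1, AlgEquiv.one_apply]

/-- `φ^k` fixes `𝒪_F`. [cite: deShalit1987, Ch. I §1.1] -/
theorem frobUnitBall_pow_algebraMap_LTCoeff (σ₀ : absoluteGaloisGroup F) (k : ℕ) (a : LTCoeff F) :
    ((frobUnitBall E σ₀ : unitBall E →+* unitBall E) ^ k) (algebraMap (LTCoeff F) (unitBall E) a) =
      algebraMap (LTCoeff F) (unitBall E) a := by
  induction k with
  | zero => rw [pow_zero, RingHom.one_def, RingHom.id_apply]
  | succ k ih => rw [pow_succ', RingHom.mul_def, RingHom.comp_apply, ih, frobUnitBall_algebraMap_LTCoeff]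

/-- ★ **The anomaly map `c ↦ c − u·φ(c)` of `𝒪_E` is injective when `u^{[E:F]} ≠ 1`** (`E/F` finite Galois): from
`c = u·φ(c)` we get `c = u^k·φ^k(c)` for all `k`, and `φ^{[E:F]} = id` gives `(1 − u^{[E:F]}) c = 0`.  This is de Shalit's `N < ∞`
(non-anomalous up to a finite index) in the currency of `LubinTateColemanRelativeCoordKernelTwo` (hypothesis `hinj`).
[cite: deShalit1987, Ch. I §3.7] -/
theorem eq_zero_of_eq_mul_frobUnitBall [IsGalois F E] (σ₀ : absoluteGaloisGroup F) (u : LTCoeff F)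
    (hu : u ^ Module.finrank F E ≠ 1) (c : unitBall E)
    (hc : c = algebraMap (LTCoeff F) (unitBall E) u * (frobUnitBall E σ₀ : unitBall E →+* unitBall E) c) : c = 0 := by
  haveI : IsDomain (unitBall E) := inferInstance
  -- `c = u^k · φ^k(c)` for all `k`
  have hk : ∀ k : ℕ, c = algebraMap (LTCoeff F) (unitBall E) u ^ k * ((frobUnitBall E σ₀ : unitBall E →+* unitBall E) ^ k) c := by
    intro k
    induction k with
    | zero => rw [pow_zero, one_mul, pow_zero, RingHom.one_def, RingHom.id_apply]
    | succ k ih =>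
      have h1 : ((frobUnitBall E σ₀ : unitBall E →+* unitBall E) ^ k) c =
          algebraMap (LTCoeff F) (unitBall E) u * ((frobUnitBall E σ₀ : unitBall E →+* unitBall E) ^ (k + 1)) c := by
        conv_lhs => rw [hc]
        rw [map_mul ((frobUnitBall E σ₀ : unitBall E →+* unitBall E) ^ k), frobUnitBall_pow_algebraMap_LTCoeff, pow_succ,
          RingHom.mul_def, RingHom.comp_apply]
      conv_lhs => rw [ih, h1]
      ring
  have hd := hk (Module.finrank F E)
  rw [frobUnitBall_pow_finrank_apply] at hd
  -- `(1 − u^d) c = 0` with `1 − u^d ≠ 0`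
  have h0 : (1 - algebraMap (LTCoeff F) (unitBall E) u ^ Module.finrank F E) * c = 0 := by
    linear_combination hd
  have hne : (1 - algebraMap (LTCoeff F) (unitBall E) u ^ Module.finrank F E) ≠ 0 := by
    intro h
    apply hu
    have h2 : algebraMap (LTCoeff F) (unitBall E) (u ^ Module.finrank F E) = algebraMap (LTCoeff F) (unitBall E) 1 := by
      rw [map_pow, map_one]; exact (sub_eq_zero.mp h).symm
    exact algebraMap_LTCoeff_injective E h2
  exact (mul_eq_zero.mp h0).resolve_left hne

end RelativeAnomalyTwo

end Literature.NumberTheory.GaloisRepresentations
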